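import Literature.Computability.Complexity.Oracle
import HarnessLib

/-!
# Absorbing part of an oracle into an oracle algorithm (run-level rerelativization)

Topic `Literature/Computability/Complexity`, companion of `Oracle.lean` (G01 transcript model: an
oracle algorithm is a step function `(input, answers so far) ↦ next query | output`, run for a
bounded number of rounds). Oracle constructions "relative to a base oracle `B`" — a machine with
oracle `B ⊕ G` analysed as a machine querying only `G`, with `B` *hard-wired* — rest on the remark
that an oracle algorithm may absorb any part of its oracle that is fixed in advance: "Fix a set
`B ⊆ ω`. Forcing and truth relative to `B` is defined just as in the unrelativized case […] All
the results of this section relativize to `B` in this manner" (Fenner–Fortnow–Kurtz–Li, *An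
oracle builder's toolkit*, Inform. and Comput. 182 (2003), §3.2, p. 14; "If our oracle
construction is relativizable (and it always is), then this assumption costs us nothing, since it
can be discharged by rerelativization", ibid. p. 34). In the transcript model this is a genuine
construction, carried out here at the level of RUNS (no running time is claimed: the absorbed
part need not be computable):

* `OracleAlg.absorbedOracle φ O'` — the oracle presented to `M` when each query `y` is treated
  according to the *view* `φ : List Bool → List Bool ⊕ List Bool`: `φ y = inl a` means "answer
  `a`" (absorbed), `φ y = inr y'` means "ask the outer oracle `O'` about `y'`";
* `OracleAlg.replay`, `OracleAlg.absorb M φ F` — the absorbed algorithm: on input `x` with the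
  outer answers received so far it replays `M` from the start, answering absorbed queries by `φ`
  and forwarded ones from the list, until `M` asks a new forwarded query (which it asks) or
  outputs (which it outputs); `F x` is the replay fuel on input `x`;
* `OracleAlg.fwd` — the forwarded queries of a run of `M`, in order;
* PROVED: `OracleAlg.replay_eq` (after the outer answers to the first `j` forwarded queries the
  replay reports the `j`-th forwarded query, or `M`'s output when there is none left),
  `OracleAlg.length_fwd_lt` (a run producing an output within `k` rounds forwards fewer than `k`
  queries), and the simulation theorem **`OracleAlg.run_absorb`**: if `M` with the absorbed
  oracle outputs `b` within `k ≤ F x` rounds, then `M.absorb φ F` with the outer oracle outputs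
  `b` within `k` rounds (`OracleAlg.runAux_absorb_of_le` is the round-by-round form).

Typical view (`Literature/Barriers/QuantumAdvantage/`, joined oracles `B ⊕ G`): `[] ↦ inl "no"`,
`0w ↦ inl [w ∈ B]`, `1w ↦ inr w`, for which `absorbedOracle φ (Oracle.ofLanguage G)` is
`Oracle.ofLanguage (B ⊕ G)`; a requirement forced against all (countably many) absorbed machines
querying `G` alone is then forced against all machines querying `B ⊕ G`.

## References

* [FennerFortnowKurtzLi2003IC] §3.2 p. 14 (relativized genericity; two predicates collapsed by
  the join), p. 34 (rerelativization), read via `lit read doi:10.1016/s0890-5401(03)00018-x`.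
* [AroraBarakCC2009] §3.4 (oracle machines; the transcript model of `Oracle.lean`).
-/

namespace Literature.Computability.Complexity

namespace OracleAlg

variable {β : Type}

/-! ### Views and the absorbed oracle -/

/-- The oracle seen by `M` under the view `φ` with outer oracle `O'`: a query `y` with
`φ y = inl a` is answered `a`, one with `φ y = inr y'` is answered `O' y'`.
[cite: FennerFortnowKurtzLi2003IC, §3.2 p. 14] -/
def absorbedOracle (φ : List Bool → List Bool ⊕ List Bool) (O' : Oracle) : Oracle :=
  fun y => Sum.elim id O' (φ y)

/-- Unfolding: an absorbed query is answered by the view. [folklore] -/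
theorem absorbedOracle_of_inl {φ : List Bool → List Bool ⊕ List Bool} {O' : Oracle} {y a : List Bool}
    (h : φ y = Sum.inl a) : absorbedOracle φ O' y = a := by
  simp [absorbedOracle, h]

/-- Unfolding: a forwarded query is answered by the outer oracle. [folklore] -/
theorem absorbedOracle_of_inr {φ : List Bool → List Bool ⊕ List Bool} {O' : Oracle} {y y' : List Bool}
    (h : φ y = Sum.inr y') : absorbedOracle φ O' y = O' y' := by
  simp [absorbedOracle, h]

/-! ### The absorbed algorithm -/

/-- `replay M φ x f inner outer`: replay `M` on input `x` from its (reconstructed) transcript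
`inner` for at most `f` steps, answering absorbed queries by the view and forwarded queries from
the list `outer` of outer answers; report the first forwarded query for which no outer answer is
left (`inl`), or `M`'s output (`inr`); junk `inl []` when the fuel runs out.
[cite: FennerFortnowKurtzLi2003IC, §3.2 p. 14] -/
def replay (M : OracleAlg β) (φ : List Bool → List Bool ⊕ List Bool) (x : List Bool) :
    ℕ → List (List Bool) → List (List Bool) → List Bool ⊕ β
  | 0, _, _ => Sum.inl []
  | f + 1, inner, outer =>
    match M.step x inner with
    | Sum.inr b => Sum.inr b
    | Sum.inl y =>
      match φ y with
      | Sum.inl a => replay M φ x f (inner ++ [a]) outer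
      | Sum.inr y' =>
        match outer with
        | [] => Sum.inl y'
        | a :: rest => replay M φ x f (inner ++ [a]) rest

/-- **The absorbed algorithm** `M.absorb φ F`: its step function on `(x, outer answers so far)`
replays `M` with fuel `F x`. It queries the outer oracle exactly at the forwarded queries of `M`.
No running-time claim is made (the view may hard-wire a non-computable set).
[cite: FennerFortnowKurtzLi2003IC, §3.2 p. 14 and p. 34 (rerelativization)] -/
def absorb (M : OracleAlg β) (φ : List Bool → List Bool ⊕ List Bool) (F : List Bool → ℕ) : OracleAlg β where
  step x outer := M.replay φ x (F x) [] outer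

/-- The forwarded queries (outer queries `y'`, in order) made by `M` on input `x` when run from the
transcript `inner` for at most `k` rounds against the absorbed oracle of `O'`. [folklore] -/
def fwd (M : OracleAlg β) (φ : List Bool → List Bool ⊕ List Bool) (O' : Oracle) (x : List Bool) :
    ℕ → List (List Bool) → List (List Bool)
  | 0, _ => []
  | k + 1, inner =>
    match M.step x inner with
    | Sum.inr _ => []
    | Sum.inl y =>
      match φ y with
      | Sum.inl a => fwd M φ O' x k (inner ++ [a])
      | Sum.inr y' => y' :: fwd M φ O' x k (inner ++ [O' y'])

section Simulation

variable (M : OracleAlg β) (φ : List Bool → List Bool ⊕ List Bool) (O' : Oracle) (x : List Bool)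

/-- A run that outputs within `k` rounds forwards fewer than `k` queries. [folklore] -/
theorem length_fwd_lt {k : ℕ} {inner : List (List Bool)} {b : β}
    (h : M.runAux (absorbedOracle φ O') x k inner = some b) : (M.fwd φ O' x k inner).length < k := by
  induction k generalizing inner with
  | zero => simp at h
  | succ k ih =>
    rw [runAux_succ] at h
    unfold fwd
    cases hs : M.step x inner with
    | inr b' => simp
    | inl y =>
      rw [hs] at h
      dsimp only at h ⊢
      cases hφ : φ y with
      | inl a =>
        rw [absorbedOracle_of_inl hφ] at h
        simpa using Nat.lt_succ_of_lt (ih h)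
      | inr y' =>
        rw [absorbedOracle_of_inr hφ] at h
        simpa using ih h

/-- **The replay reports the forwarded queries in order, then the output.** If `M` with the
absorbed oracle outputs `b` within `k ≤ f` rounds from the transcript `inner`, then, fed with the
outer answers to the first `j` forwarded queries, `replay` reports the `j`-th forwarded query, or
`b` if there are only `≤ j` of them. [cite: FennerFortnowKurtzLi2003IC, §3.2 p. 14] -/
theorem replay_eq {k f : ℕ} (hkf : k ≤ f) {inner : List (List Bool)} {b : β}
    (h : M.runAux (absorbedOracle φ O') x k inner = some b) (j : ℕ) :
    M.replay φ x f inner (((M.fwd φ O' x k inner).take j).map O') =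
      ((M.fwd φ O' x k inner)[j]?).elim (Sum.inr b) Sum.inl := by
  induction k generalizing f inner j with
  | zero => simp at h
  | succ k ih =>
    obtain ⟨f, rfl⟩ : ∃ f', f = f' + 1 := ⟨f - 1, by omega⟩
    have hkf' : k ≤ f := by omega
    rw [runAux_succ] at h
    unfold fwd replay
    cases hs : M.step x inner with
    | inr b' =>
      rw [hs] at h
      simp only [Option.some.injEq] at h
      subst h
      simp
    | inl y =>
      rw [hs] at h
      dsimp only at h ⊢
      cases hφ : φ y with
      | inl a =>
        rw [absorbedOracle_of_inl hφ] at h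
        simpa using ih hkf' h j
      | inr y' =>
        rw [absorbedOracle_of_inr hφ] at h
        cases j with
        | zero => simp
        | succ j => simpa using ih hkf' h j

/-- The outer run of the absorbed algorithm from the answers to the first `j` forwarded queries:
it asks the remaining forwarded queries and outputs `b`. [folklore] -/
theorem runAux_absorb_of_le {k : ℕ} {F : List Bool → ℕ} (hkF : k ≤ F x) {b : β}
    (h : M.runAux (absorbedOracle φ O') x k [] = some b) (j : ℕ) (hj : j ≤ (M.fwd φ O' x k []).length) :
    (M.absorb φ F).runAux O' x ((M.fwd φ O' x k []).length - j + 1)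
        (((M.fwd φ O' x k []).take j).map O') = some b := by
  set L := M.fwd φ O' x k [] with hL
  induction hd : L.length - j generalizing j with
  | zero =>
    have hjL : L.length ≤ j := Nat.sub_eq_zero_iff_le.1 hd
    rw [runAux_succ]
    change (match M.replay φ x (F x) [] ((L.take j).map O') with
      | Sum.inl q => (M.absorb φ F).runAux O' x 0 (((L.take j).map O') ++ [O' q])
      | Sum.inr b => some b) = some b
    rw [hL, M.replay_eq φ O' x hkF h j, List.getElem?_eq_none (by rwa [← hL])]
    rfl
  | succ d ihd =>
    have hjL : j < L.length := by omega
    rw [runAux_succ]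
    change (match M.replay φ x (F x) [] ((L.take j).map O') with
      | Sum.inl q => (M.absorb φ F).runAux O' x (d + 1) (((L.take j).map O') ++ [O' q])
      | Sum.inr b => some b) = some b
    rw [hL, M.replay_eq φ O' x hkF h j, List.getElem?_eq_getElem (by rwa [← hL])]
    change (M.absorb φ F).runAux O' x (d + 1) (((L.take j).map O') ++ [O' L[j]]) = some b
    have htake : ((L.take j).map O') ++ [O' L[j]] = (L.take (j + 1)).map O' := by
      rw [List.take_succ_eq_append_getElem hjL, List.map_append, List.map_singleton]
    rw [htake]
    exact ihd (j + 1) hjL (by omega)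

/-- **Simulation theorem.** If `M` with the absorbed oracle `absorbedOracle φ O'` outputs `b`
within `k` rounds on `x`, and the replay fuel suffices (`k ≤ F x`), then the absorbed algorithm
with the outer oracle `O'` outputs `b` within `k` rounds on `x`.
[cite: FennerFortnowKurtzLi2003IC, §3.2 p. 14 and p. 34] -/
theorem run_absorb {k : ℕ} {F : List Bool → ℕ} (hkF : k ≤ F x) {b : β}
    (h : M.run (absorbedOracle φ O') k x = some b) : (M.absorb φ F).run O' k x = some b := by
  have h0 := M.runAux_absorb_of_le φ O' x hkF h 0 (Nat.zero_le _)
  simp only [Nat.sub_zero, List.take_zero, List.map_nil] at h0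
  exact (M.absorb φ F).runAux_mono O' x (M.length_fwd_lt φ O' x h) h0

end Simulation

end OracleAlg

end Literature.Computability.Complexity
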